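import Summits.QuantumFields.BalabanUV.Beta.EriceRemainderEnclosureHistoryAutonomyComparisonPerron

/-!
# EriceRemainderEnclosureHistoryAutonomyComparisonPerronDual — (E49d) THE MINIMAL SOLUTION AND COMPARISON FROM BELOW for memory antitone in the older
# couplings (Perron's method, dual side): same class as (E49c) — `B` with zeroth moment `M ≥ 0` of ANY size, floor `b > 0` on ]0,γ]^ℕ, non-increasing in
# the OLDER couplings, the newest coupling free (continuous).  The pointwise INFIMUM of the box SUPER-solutions (`1∕v(m+1)² ≤ 1∕v(m)² + B(v(m+1), …)`,
# `v 0 ≥ p`) is the MINIMAL box solution from `p`; box solutions of any `B″ ≤ B` from pins `≥ p` are super-solutions of `B`, hence lie ABOVE it; with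
# (E49c)'s maximal solution the box solutions of `B` from `p` are BRACKETED, `u⁻ ≤ w ≤ u⁺`, and uniquely solvable iff `u⁻ = u⁺`; under uniqueness
# `B″ ≤ B ⟹ h ≤ h″` at every scale, so with (E49c): `B″ ≤ B ≤ B′ ⟹ h′ ≤ h ≤ h″`

Cell `pub-balaban`, β-function sub-cell, BINDER row D4 «RemainderConst leaves for Bałaban's split» (`HOME/BINDER-OWNERS.md`; owner lineage `b2b-balaban-beta-an4`;
this file by co-owner #2 lineage `b2b-balaban-beta-d4-p2`, generation 46), β-FLOW TEAM duty (1), FREEZE (0) honoured (def-free; (E49c)'s `seqBox_update` ∕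
`abs_newest_sub_le` ∕ `continuousOn_oneStepExpr` ∕ `update_newest_self` ∕ `exists_max_memFlow_of_tailAntitone`, node U2's `MemFlow` ∕ `SeqBox` ∕ `seqBox_shift` ∕
`one_div_sqrt_le` ∕ `one_div_sq_one_div_sqrt`, (E37b)'s `le_upper_zm` ∕ `lower_le_upper_zm`, (E38a)'s `memFlow_unique_zs_closed` BY NAME, nothing restated).
Sequel of (E49c) `…HistoryAutonomyComparisonPerron`; companions (E49a) `…HistoryAutonomyComparison`, (E49b) `…HistoryAutonomyComparisonWitness`.

HONEST FRAMING (page 1, verbatim and binding).  *"Discharging BetaPertH makes Bałaban's UV stability UNCONDITIONAL — a real constructive-QFT result; it is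
NOT the continuum limit and NOT the Clay problem."*  THIS FILE DISCHARGES NOTHING OF THE KIND.  Pure real analysis about an ABSTRACT functional with
displayed zeroth moment, floor and sign of the memory — hypotheses, not facts; the sign of Bałaban's limit functional in its older couplings is NOT
PRINTED ([I] p. 298; GAPS G-t4-U2-1∕-2) and not asserted.  Row D4 class UNCHANGED (critical-path width 0; instance 0∕1; D4 DISCHARGE NO DATE).  HONEST
DEPENDENCY: continuum YM on T⁴ ⇐ BetaPertH ∧ nine spine estimates (0/9 proved); BetaPertH ⇐ (D1) ∧ (D4) ∧ CAP+tail; G-an2-4 gates asym, D1 and NE2/3/4.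

THE POINT (census sense (α)).  The dual of (E49c): `S⁺` = box super-solutions started at or above `p` (`∋` the constant history `p`; members stay above
the `U`-envelope), `u = inf S⁺` pointwise.  (i) `u ∈ S⁺` by the same continuity step (older couplings SMALLER ⟹ `B` LARGER); (ii) equality: if the
one-step expression `Ψ(x) = 1∕x² − B(x; u-tail)` is `< 1∕u(m)²` at `x = u(m+1)`, then at `y₀ = (1∕u(m)² + U)^{-1∕2} ≤ u(m+1)` it is `≥ 1∕u(m)²`
(`B ≤ U`), the intermediate value theorem gives `c < u(m+1)` with `Ψ(c) = 1∕u(m)²`, and `u` with `u(m+1)` LOWERED to `c` is again a super-solution (an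
older coupling was lowered at every earlier scale, `B` antitone there) — contradicting `u = inf S⁺`.  Consequences: comparison from below, the bracket,
two-sided comparison under uniqueness and on the closed threshold.

WHAT IS PROVED ([folklore]; 0 `def`, 0 sorry).  §1 `envelope_le_of_super`, **`exists_min_memFlow_of_tailAntitone`**.  §2 `super_of_memFlow_of_le_functional`,
**`exists_memFlow_le_of_le_functional`**, **`exists_bracket_of_tailAntitone`** (uniqueness ⟺ `u⁻ = u⁺`), **`le_of_le_functional`**, **`le_of_le_functional_zs_closed`**,
**`sandwich_zs_closed`**.
-/

noncomputable section
open Finset Set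

namespace Summit.QuantumFields.BalabanUV.Beta.EriceRemainderEnclosureHistoryAutonomyComparisonPerronDual

open Literature.MathematicalPhysics.QuantumFieldTheory.Balaban1983to89
open Literature.MathematicalPhysics.QuantumFieldTheory.Balaban1983to89.T4BetaStationary
open Literature.MathematicalPhysics.QuantumFieldTheory.Balaban1983to89.T4BetaFlowWellPosed
open Summit.QuantumFields.BalabanUV.Beta.EriceRemainderEnclosureHistoryAutonomyWellPosed (le_upper_zm lower_le_upper_zm)
open Summit.QuantumFields.BalabanUV.Beta.EriceRemainderEnclosureHistoryAutonomyThreshold (memFlow_unique_zs_closed)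
open Summit.QuantumFields.BalabanUV.Beta.EriceRemainderEnclosureHistoryAutonomyComparisonPerron

variable {B B' : (ℕ → ℝ) → ℝ} {M γ b p : ℝ} {h h' t : ℕ → ℝ} {x x' : ℝ}

/-! ## §1 The infimum of the box super-solutions is the minimal box solution -/

/-- A SUPER-SOLUTION (`1∕v(m+1)² ≤ 1∕v(m)² + B(v(m+1), …)`) started at or above `p` stays above the `U`-envelope of `p` (`B ≤ U` on the box).
[folklore] -/
theorem envelope_le_of_super {U : ℝ} (hp : 0 < p) (hup : ∀ u, SeqBox γ u → B u ≤ U) {v : ℕ → ℝ} (hv : SeqBox γ v) (hv0 : p ≤ v 0)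
    (hsup : ∀ m, 1 / v (m + 1) ^ 2 ≤ 1 / v m ^ 2 + B (fun j => v (m + 1 + j))) (m : ℕ) :
    1 / Real.sqrt (1 / p ^ 2 + (m : ℝ) * U) ≤ v m := by
  have hrec : ∀ m : ℕ, 1 / v m ^ 2 ≤ 1 / p ^ 2 + (m : ℝ) * U := by
    intro m
    induction m with
    | zero =>
      simp only [Nat.cast_zero, zero_mul, add_zero]
      exact one_div_le_one_div_of_le (pow_pos hp 2) (pow_le_pow_left₀ hp.le hv0 2)
    | succ m ih =>
      rw [Nat.cast_succ]
      have := hup _ (seqBox_shift hv (m + 1))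
      linarith [hsup m]
  exact one_div_sqrt_le (hv m).1 (hrec m)

/-- **THE MINIMAL BOX SOLUTION FOR MEMORY ANTITONE IN THE OLDER COUPLINGS (Perron, dual).**  Same class as `exists_max_memFlow_of_tailAntitone`.
The pointwise INFIMUM of all box super-solutions started at or above `p` is a box solution from `p` lying below every such super-solution — in
particular below every box solution from every pin `≥ p` in ]0,γ]. [folklore] -/
theorem exists_min_memFlow_of_tailAntitone
    (htail : ∀ u u' : ℕ → ℝ, SeqBox γ u → SeqBox γ u' → u 0 = u' 0 → (∀ j, u (j + 1) ≤ u' (j + 1)) → B u' ≤ B u)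
    (hB : ∀ u u' : ℕ → ℝ, SeqBox γ u → SeqBox γ u' → ∀ D : ℝ, (∀ j, |u j - u' j| ≤ D) → |B u - B u'| ≤ M * D)
    (hM : 0 ≤ M) (hp : 0 < p) (hpγ : p ≤ γ) (hb : 0 < b) (hlo : ∀ u, SeqBox γ u → b ≤ B u) :
    ∃ u : ℕ → ℝ, SeqBox γ u ∧ MemFlow B p u ∧
      ∀ v : ℕ → ℝ, SeqBox γ v → p ≤ v 0 → (∀ m, 1 / v (m + 1) ^ 2 ≤ 1 / v m ^ 2 + B (fun j => v (m + 1 + j))) →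
        ∀ m, u m ≤ v m := by
  have hγ : 0 < γ := hp.trans_le hpγ
  set U : ℝ := B (fun _ => γ) + M * γ with hU_def
  have hup : ∀ u, SeqBox γ u → B u ≤ U := fun u hu => le_upper_zm hB hγ hu
  have hU : 0 ≤ U := hb.le.trans (lower_le_upper_zm hM hγ hlo)
  set S : Set (ℕ → ℝ) :=
    {v | SeqBox γ v ∧ p ≤ v 0 ∧ ∀ m, 1 / v (m + 1) ^ 2 ≤ 1 / v m ^ 2 + B (fun j => v (m + 1 + j))} with hS_def
  set e : ℕ → ℝ := fun m : ℕ => 1 / Real.sqrt (1 / p ^ 2 + (m : ℝ) * U) with he_def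
  have he_pos : ∀ m, 0 < e m := fun m => one_div_pos.mpr (Real.sqrt_pos.mpr (by positivity))
  have he_le : ∀ v ∈ S, ∀ m, e m ≤ v m := fun v hv m => envelope_le_of_super hp hup hv.1 hv.2.1 hv.2.2 m
  -- the constant history `p` is a member
  have hcbox : SeqBox γ (fun _ : ℕ => p) := fun _ => ⟨hp, hpγ⟩
  have hc : (fun _ : ℕ => p) ∈ S :=
    ⟨hcbox, le_rfl, fun m => by linarith [hlo _ (seqBox_shift hcbox (m + 1))]⟩
  -- the infimum
  set u : ℕ → ℝ := fun m => sInf ((fun v : ℕ → ℝ => v m) '' S) with hu_def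
  have hne : ∀ m, ((fun v : ℕ → ℝ => v m) '' S).Nonempty := fun m => ⟨p, _, hc, rfl⟩
  have hbdd : ∀ m, BddBelow ((fun v : ℕ → ℝ => v m) '' S) := fun m =>
    ⟨e m, by rintro _ ⟨v, hv, rfl⟩; exact he_le v hv m⟩
  have hu_le : ∀ v ∈ S, ∀ m, u m ≤ v m := fun v hv m => csInf_le (hbdd m) ⟨v, hv, rfl⟩
  have he_le_u : ∀ m, e m ≤ u m := fun m => le_csInf (hne m) (by rintro _ ⟨v, hv, rfl⟩; exact he_le v hv m)
  have hu_le_p : ∀ m, u m ≤ p := fun m => hu_le _ hc m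
  have hu_box : SeqBox γ u := fun m => ⟨(he_pos m).trans_le (he_le_u m), (hu_le_p m).trans hpγ⟩
  have hu0 : u 0 = p := le_antisymm (hu_le_p 0) (le_csInf (hne 0) (by rintro _ ⟨v, hv, rfl⟩; exact hv.2.1))
  have hlt_of_mem : ∀ {m} {y : ℝ}, u m < y → ∃ v ∈ S, v m < y := by
    intro m y hy
    obtain ⟨_, ⟨v, hv, rfl⟩, hyv⟩ := exists_lt_of_csInf_lt (hne m) hy
    exact ⟨v, hv, hyv⟩
  -- (i) the infimum is a super-solution
  have hsup_u : ∀ m, 1 / u (m + 1) ^ 2 ≤ 1 / u m ^ 2 + B (fun j => u (m + 1 + j)) := by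
    intro m
    set t : ℕ → ℝ := fun j => u (m + 1 + j) with ht_def
    have ht : SeqBox γ t := seqBox_shift hu_box (m + 1)
    have ht0 : t 0 = u (m + 1) := by simp [ht_def]
    have hx : 0 < u (m + 1) := (hu_box (m + 1)).1
    have hxγ : u (m + 1) ≤ γ := (hu_box (m + 1)).2
    refine le_of_not_gt fun hcon => ?_
    set A : ℝ := 1 / u m ^ 2 with hA_def
    set η : ℝ := 1 / u (m + 1) ^ 2 - A - B t with hη_def
    have hη : 0 < η := by rw [hη_def]; linarith
    have hcont : ContinuousAt (fun y : ℝ => 1 / y ^ 2) (u (m + 1)) :=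
      continuousAt_const.div (continuousAt_id.pow 2) (pow_ne_zero 2 hx.ne')
    obtain ⟨δ₁, hδ₁, hδ₁'⟩ := Metric.continuousAt_iff.mp hcont (η / 2) (by linarith)
    set δ : ℝ := min δ₁ (η / (2 * (M + 1))) with hδ_def
    have hδ : 0 < δ := lt_min hδ₁ (div_pos hη (by linarith))
    obtain ⟨v, hv, hyv⟩ := hlt_of_mem (m := m + 1) (y := u (m + 1) + δ) (by linarith)
    have hvge : u (m + 1) ≤ v (m + 1) := hu_le v hv (m + 1)
    have hv0 : 0 < v (m + 1) := (hv.1 (m + 1)).1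
    have hvγ : v (m + 1) ≤ γ := (hv.1 (m + 1)).2
    have hdist : |v (m + 1) - u (m + 1)| < δ := by rw [abs_sub_lt_iff]; constructor <;> linarith
    have h1 : 1 / v (m + 1) ^ 2 ≤ 1 / v m ^ 2 + B (fun j => v (m + 1 + j)) := hv.2.2 m
    have h2 : 1 / v m ^ 2 ≤ A :=
      one_div_le_one_div_of_le (pow_pos (hu_box m).1 2) (pow_le_pow_left₀ (hu_box m).1.le (hu_le v hv m) 2)
    have h3 : B (fun j => v (m + 1 + j)) ≤ B (Function.update t 0 (v (m + 1))) := by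
      refine htail _ _ (seqBox_update ht hv0 hvγ) (seqBox_shift hv.1 (m + 1)) ?_ fun j => ?_
      · simp [Function.update_self]
      · rw [Function.update_of_ne (Nat.succ_ne_zero j), ht_def]
        simp only
        rw [show m + 1 + (j + 1) = m + 1 + j + 1 by ring]
        exact hu_le v hv (m + 1 + j + 1)
    have h4 : |1 / v (m + 1) ^ 2 - 1 / u (m + 1) ^ 2| < η / 2 := by
      have := hδ₁' (x := v (m + 1)) (by rw [Real.dist_eq]; exact hdist.trans_le (min_le_left _ _))
      rwa [Real.dist_eq] at this
    have h5 : |B (Function.update t 0 (v (m + 1))) - B (Function.update t 0 (u (m + 1)))| < η / 2 := by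
      calc |B (Function.update t 0 (v (m + 1))) - B (Function.update t 0 (u (m + 1)))|
          ≤ M * |v (m + 1) - u (m + 1)| := abs_newest_sub_le hB ht hv0 hvγ hx hxγ
        _ ≤ M * (η / (2 * (M + 1))) := mul_le_mul_of_nonneg_left (hdist.le.trans (min_le_right _ _)) hM
        _ < η / 2 := by
            rw [mul_div_assoc', div_lt_div_iff₀ (by positivity) (by norm_num)]
            nlinarith
    have h6 : Function.update t 0 (u (m + 1)) = t := by rw [← ht0]; exact update_newest_self t
    rw [h6] at h5
    rw [abs_sub_lt_iff] at h4 h5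
    linarith [h4.1, h4.2, h5.1, h5.2]
  -- (ii) the infimum is a solution
  have heq_u : ∀ m, 1 / u (m + 1) ^ 2 = 1 / u m ^ 2 + B (fun j => u (m + 1 + j)) := by
    intro m
    set t : ℕ → ℝ := fun j => u (m + 1 + j) with ht_def
    have ht : SeqBox γ t := seqBox_shift hu_box (m + 1)
    have ht0 : t 0 = u (m + 1) := by simp [ht_def]
    have hx : 0 < u (m + 1) := (hu_box (m + 1)).1
    have hxγ : u (m + 1) ≤ γ := (hu_box (m + 1)).2
    refine le_antisymm (hsup_u m) (le_of_not_gt fun hcon => ?_)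
    set A : ℝ := 1 / u m ^ 2 with hA_def
    set Ψ : ℝ → ℝ := fun y => 1 / y ^ 2 - B (Function.update t 0 y) with hΨ_def
    have hΨx : Ψ (u (m + 1)) < A := by
      simp only [hΨ_def]
      rw [← ht0, update_newest_self t, ht0]; linarith
    -- a point below where the one-step expression is at least `A`
    have hA : 0 < A := by rw [hA_def]; exact one_div_pos.mpr (pow_pos (hu_box m).1 2)
    have hAU : 0 < A + U := by linarith
    set y₀ : ℝ := 1 / Real.sqrt (A + U) with hy₀_def
    have hy₀pos : 0 < y₀ := one_div_pos.mpr (Real.sqrt_pos.mpr hAU)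
    have hy₀sq : 1 / y₀ ^ 2 = A + U := one_div_sq_one_div_sqrt hAU
    have hy₀le : y₀ ≤ u (m + 1) := by
      refine one_div_sqrt_le hx ?_
      have := hup _ ht
      linarith [hsup_u m]
    have hy₀γ : y₀ ≤ γ := hy₀le.trans hxγ
    have hΨy₀ : A ≤ Ψ y₀ := by
      simp only [hΨ_def]
      rw [hy₀sq]
      linarith [hup _ (seqBox_update ht hy₀pos hy₀γ)]
    have hcontΨ : ContinuousOn Ψ (Icc y₀ (u (m + 1))) := continuousOn_oneStepExpr hB hM ht hy₀pos hxγ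
    obtain ⟨c, hc, hΨc⟩ : ∃ c ∈ Icc y₀ (u (m + 1)), Ψ c = A :=
      intermediate_value_Icc' hy₀le hcontΨ ⟨hΨx.le, hΨy₀⟩
    have hcx : c < u (m + 1) := by
      rcases hc.2.eq_or_lt with heq | hlt
      · rw [heq] at hΨc; exact absurd hΨc hΨx.ne
      · exact hlt
    have hc0 : 0 < c := hy₀pos.trans_le hc.1
    have hcγ : c ≤ γ := hc.2.trans hxγ
    -- the lowered history
    set w : ℕ → ℝ := Function.update u (m + 1) c with hw_def
    have hw_at : w (m + 1) = c := by simp [hw_def]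
    have hw_ne : ∀ k, k ≠ m + 1 → w k = u k := fun k hk => by simp [hw_def, Function.update_of_ne hk]
    have hw_le : ∀ k, w k ≤ u k := by
      intro k
      rcases eq_or_ne k (m + 1) with rfl | hk
      · rw [hw_at]; exact hcx.le
      · rw [hw_ne k hk]
    have hw_box : SeqBox γ w := by
      intro k
      rcases eq_or_ne k (m + 1) with rfl | hk
      · rw [hw_at]; exact ⟨hc0, hcγ⟩
      · rw [hw_ne k hk]; exact hu_box k
    have hw0 : p ≤ w 0 := by rw [hw_ne 0 (by omega), hu0]
    have hw_sup : ∀ k, 1 / w (k + 1) ^ 2 ≤ 1 / w k ^ 2 + B (fun j => w (k + 1 + j)) := by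
      intro k
      rcases eq_or_ne k m with rfl | hkm
      · have htail_eq : (fun j => w (k + 1 + j)) = Function.update t 0 c := by
          funext j
          rcases eq_or_ne j 0 with rfl | hj
          · rw [Function.update_self, add_zero, hw_at]
          · rw [Function.update_of_ne hj, hw_ne _ (by omega), ht_def]
        rw [htail_eq, hw_ne k (by omega), hw_at]
        have : Ψ c = 1 / c ^ 2 - B (Function.update t 0 c) := rfl
        linarith [hΨc]
      rcases eq_or_ne k (m + 1) with rfl | hkm1
      · have htail_eq : (fun j => w (m + 1 + 1 + j)) = fun j => u (m + 1 + 1 + j) :=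
          funext fun j => hw_ne _ (by omega)
        rw [htail_eq, hw_at, hw_ne _ (by omega)]
        have h1 := hsup_u (m + 1)
        have h2 : 1 / u (m + 1) ^ 2 ≤ 1 / c ^ 2 :=
          one_div_le_one_div_of_le (pow_pos hc0 2) (pow_le_pow_left₀ hc0.le hcx.le 2)
        linarith
      · rw [hw_ne k hkm1, hw_ne (k + 1) (by omega)]
        have h1 := hsup_u k
        have h2 : B (fun j => u (k + 1 + j)) ≤ B (fun j => w (k + 1 + j)) :=
          htail _ _ (seqBox_shift hw_box (k + 1)) (seqBox_shift hu_box (k + 1)) (by simp [hw_ne (k + 1) (by omega)])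
            fun j => hw_le (k + 1 + (j + 1))
        linarith
    have hwS : w ∈ S := ⟨hw_box, hw0, hw_sup⟩
    have := hu_le w hwS (m + 1)
    rw [hw_at] at this
    linarith
  exact ⟨u, hu_box, ⟨hu0, heq_u⟩, fun v hv hv0 hsup m => hu_le v ⟨hv, hv0, hsup⟩ m⟩

/-! ## §2 COMPARISON FROM BELOW; the bracket; the sandwich -/

/-- Dually: every box solution of a SMALLER functional `B″ ≤ B` from a pin `p₀ ≥ p` is a super-solution of `B` started at or above `p`. [folklore] -/
theorem super_of_memFlow_of_le_functional {B'' : (ℕ → ℝ) → ℝ} {p₀ : ℝ} {h'' : ℕ → ℝ}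
    (hB''B : ∀ u, SeqBox γ u → B'' u ≤ B u) (hpp₀ : p ≤ p₀) (hh'' : SeqBox γ h'') (hf'' : MemFlow B'' p₀ h'') :
    p ≤ h'' 0 ∧ ∀ m, 1 / h'' (m + 1) ^ 2 ≤ 1 / h'' m ^ 2 + B (fun j => h'' (m + 1 + j)) :=
  ⟨hpp₀.trans_eq hf''.1.symm, fun m => by rw [hf''.2 m]; linarith [hB''B _ (seqBox_shift hh'' (m + 1))]⟩

/-- **COMPARISON FROM BELOW, memory antitone in the older couplings**: `B″ ≤ B` on the box (arbitrary otherwise), `h″` any box solution of `B″`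
from a pin `p₀ ∈ [p, γ]` ⟹ there is a box solution `u` of `B` from `p` with `u ≤ h″` at every scale. [folklore] -/
theorem exists_memFlow_le_of_le_functional {B'' : (ℕ → ℝ) → ℝ} {p₀ : ℝ} {h'' : ℕ → ℝ}
    (htail : ∀ u u' : ℕ → ℝ, SeqBox γ u → SeqBox γ u' → u 0 = u' 0 → (∀ j, u (j + 1) ≤ u' (j + 1)) → B u' ≤ B u)
    (hB : ∀ u u' : ℕ → ℝ, SeqBox γ u → SeqBox γ u' → ∀ D : ℝ, (∀ j, |u j - u' j| ≤ D) → |B u - B u'| ≤ M * D)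
    (hM : 0 ≤ M) (hp : 0 < p) (hpγ : p ≤ γ) (hb : 0 < b) (hlo : ∀ u, SeqBox γ u → b ≤ B u)
    (hB''B : ∀ u, SeqBox γ u → B'' u ≤ B u) (hpp₀ : p ≤ p₀) (hh'' : SeqBox γ h'') (hf'' : MemFlow B'' p₀ h'') :
    ∃ u : ℕ → ℝ, SeqBox γ u ∧ MemFlow B p u ∧ ∀ m, u m ≤ h'' m := by
  obtain ⟨u, hu, hf, hmin⟩ := exists_min_memFlow_of_tailAntitone htail hB hM hp hpγ hb hlo
  obtain ⟨h0, hsup⟩ := super_of_memFlow_of_le_functional hB''B hpp₀ hh'' hf''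
  exact ⟨u, hu, hf, hmin h'' hh'' h0 hsup⟩

/-- **THE SOLUTION SET IS BRACKETED** (memory antitone in the older couplings): there are box solutions `u⁻ ≤ u⁺` from `p` with `u⁻ ≤ w ≤ u⁺` at
every scale for EVERY box solution `w` from `p`; unique solvability from `p` iff `u⁻ = u⁺`. [folklore] -/
theorem exists_bracket_of_tailAntitone
    (htail : ∀ u u' : ℕ → ℝ, SeqBox γ u → SeqBox γ u' → u 0 = u' 0 → (∀ j, u (j + 1) ≤ u' (j + 1)) → B u' ≤ B u)
    (hB : ∀ u u' : ℕ → ℝ, SeqBox γ u → SeqBox γ u' → ∀ D : ℝ, (∀ j, |u j - u' j| ≤ D) → |B u - B u'| ≤ M * D)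
    (hM : 0 ≤ M) (hp : 0 < p) (hpγ : p ≤ γ) (hb : 0 < b) (hlo : ∀ u, SeqBox γ u → b ≤ B u) :
    ∃ lo hi : ℕ → ℝ, SeqBox γ lo ∧ MemFlow B p lo ∧ SeqBox γ hi ∧ MemFlow B p hi ∧ (∀ m, lo m ≤ hi m) ∧
      (∀ w : ℕ → ℝ, SeqBox γ w → MemFlow B p w → ∀ m, lo m ≤ w m ∧ w m ≤ hi m) ∧
      ((∀ w w' : ℕ → ℝ, SeqBox γ w → SeqBox γ w' → MemFlow B p w → MemFlow B p w' → w = w') ↔ lo = hi) := by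
  obtain ⟨hi, hhi, hfhi, hmax⟩ := exists_max_memFlow_of_tailAntitone htail hB hM hp hpγ hb hlo
  obtain ⟨lo, hlo', hflo, hmin⟩ := exists_min_memFlow_of_tailAntitone htail hB hM hp hpγ hb hlo
  have hbr : ∀ w : ℕ → ℝ, SeqBox γ w → MemFlow B p w → ∀ m, lo m ≤ w m ∧ w m ≤ hi m := fun w hw hfw m =>
    ⟨hmin w hw hfw.1.ge (fun m => (hfw.2 m).le) m, hmax w hw hfw.1.le (fun m => (hfw.2 m).ge) m⟩
  refine ⟨lo, hi, hlo', hflo, hhi, hfhi, fun m => (hbr lo hlo' hflo m).2, hbr, ⟨fun H => H lo hi hlo' hhi hflo hfhi, fun H => ?_⟩⟩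
  intro w w' hw hw' hfw hfw'
  funext m
  have h1 := hbr w hw hfw m
  have h2 := hbr w' hw' hfw' m
  rw [H] at h1 h2
  exact le_antisymm (h1.2.trans h2.1) (h2.2.trans h1.1)

/-- **… FROM BELOW**: `B″ ≤ B` on the box, `h″` any box solution of `B″` from a pin `p₀ ∈ [p, γ]` ⟹ `h ≤ h″` at every scale for the box
solution `h` of `B` from `p` (unique). [folklore] -/
theorem le_of_le_functional {B'' : (ℕ → ℝ) → ℝ} {p₀ : ℝ} {h'' : ℕ → ℝ}
    (htail : ∀ u u' : ℕ → ℝ, SeqBox γ u → SeqBox γ u' → u 0 = u' 0 → (∀ j, u (j + 1) ≤ u' (j + 1)) → B u' ≤ B u)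
    (hB : ∀ u u' : ℕ → ℝ, SeqBox γ u → SeqBox γ u' → ∀ D : ℝ, (∀ j, |u j - u' j| ≤ D) → |B u - B u'| ≤ M * D)
    (hM : 0 ≤ M) (hp : 0 < p) (hpγ : p ≤ γ) (hb : 0 < b) (hlo : ∀ u, SeqBox γ u → b ≤ B u)
    (huniq : ∀ w w' : ℕ → ℝ, SeqBox γ w → SeqBox γ w' → MemFlow B p w → MemFlow B p w' → w = w')
    (hB''B : ∀ u, SeqBox γ u → B'' u ≤ B u) (hpp₀ : p ≤ p₀) (hh : SeqBox γ h) (hf : MemFlow B p h) (hh'' : SeqBox γ h'')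
    (hf'' : MemFlow B'' p₀ h'') (m : ℕ) : h m ≤ h'' m := by
  obtain ⟨u, hu, hfu, hle⟩ := exists_memFlow_le_of_le_functional htail hB hM hp hpγ hb hlo hB''B hpp₀ hh'' hf''
  rw [huniq h u hh hu hf hfu]
  exact hle m

/-- **… AND FROM BELOW on the closed threshold**: `B″ ≤ B` on the box, `h″` a box solution of `B″` from `p₀ ∈ [p, γ]` ⟹ `h ≤ h″`. [folklore] -/
theorem le_of_le_functional_zs_closed {B'' : (ℕ → ℝ) → ℝ} {p₀ : ℝ} {h'' : ℕ → ℝ}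
    (htail : ∀ u u' : ℕ → ℝ, SeqBox γ u → SeqBox γ u' → u 0 = u' 0 → (∀ j, u (j + 1) ≤ u' (j + 1)) → B u' ≤ B u)
    (hB : ∀ u u' : ℕ → ℝ, SeqBox γ u → SeqBox γ u' → ∀ D : ℝ, (∀ j, |u j - u' j| ≤ D) → |B u - B u'| ≤ M * D)
    (hM : 0 ≤ M) (hp : 0 < p) (hpγ : p ≤ γ) (hb : 0 < b) (hlo : ∀ u, SeqBox γ u → b ≤ B u)
    (hsmall : M * γ ≤ 3 * Real.sqrt 3 * b) (hB''B : ∀ u, SeqBox γ u → B'' u ≤ B u) (hpp₀ : p ≤ p₀)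
    (hh : SeqBox γ h) (hf : MemFlow B p h) (hh'' : SeqBox γ h'') (hf'' : MemFlow B'' p₀ h'') (m : ℕ) : h m ≤ h'' m :=
  le_of_le_functional htail hB hM hp hpγ hb hlo
    (fun _ _ hw hw' hfw hfw' => memFlow_unique_zs_closed hB hM hp hpγ hb hlo hsmall hw hw' hfw hfw') hB''B hpp₀ hh hf hh'' hf'' m

/-- **THE SANDWICH ON THE CLOSED THRESHOLD**: `B″ ≤ B ≤ B′` on the box, `B` with zeroth moment `M ≥ 0`, floor `b > 0`, `M·γ ≤ 3√3·b`, non-increasing in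
the older couplings; `h, h′, h″` box solutions of `B, B′, B″` from one pin `p ∈ ]0,γ]` ⟹ `h′ ≤ h ≤ h″` at every scale ((E49c)'s upper half BY NAME). [folklore] -/
theorem sandwich_zs_closed {B'' : (ℕ → ℝ) → ℝ} {h'' : ℕ → ℝ}
    (htail : ∀ u u' : ℕ → ℝ, SeqBox γ u → SeqBox γ u' → u 0 = u' 0 → (∀ j, u (j + 1) ≤ u' (j + 1)) → B u' ≤ B u)
    (hB : ∀ u u' : ℕ → ℝ, SeqBox γ u → SeqBox γ u' → ∀ D : ℝ, (∀ j, |u j - u' j| ≤ D) → |B u - B u'| ≤ M * D)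
    (hM : 0 ≤ M) (hp : 0 < p) (hpγ : p ≤ γ) (hb : 0 < b) (hlo : ∀ u, SeqBox γ u → b ≤ B u)
    (hsmall : M * γ ≤ 3 * Real.sqrt 3 * b) (hB''B : ∀ u, SeqBox γ u → B'' u ≤ B u) (hBB' : ∀ u, SeqBox γ u → B u ≤ B' u)
    (hh : SeqBox γ h) (hf : MemFlow B p h) (hh' : SeqBox γ h') (hf' : MemFlow B' p h') (hh'' : SeqBox γ h'')
    (hf'' : MemFlow B'' p h'') (m : ℕ) : h' m ≤ h m ∧ h m ≤ h'' m :=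
  ⟨le_of_functional_le_zs_closed htail hB hM hp hpγ hb hlo hsmall hBB' le_rfl hh hf hh' hf' m,
    le_of_le_functional_zs_closed htail hB hM hp hpγ hb hlo hsmall hB''B le_rfl hh hf hh'' hf'' m⟩

end Summit.QuantumFields.BalabanUV.Beta.EriceRemainderEnclosureHistoryAutonomyComparisonPerronDual

end
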